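import Summits.HodgeConjecture.CorCM.TwoSimpleCMSurfacesHodge
import Summits.HodgeConjecture.CorCM.ImaginaryQuadraticsTimesConjSquareCMHodge
import Summits.HodgeConjecture.CorCM.ForeignQuadraticCMFieldsHodge
import Summits.HodgeConjecture.CorCM.QuadraticCMFamiliesHodge
import HarnessLib

/-!
# Pairwise non-isogenous CM elliptic curves times ANY two simple non-isogenous CM abelian surfaces: a nondegenerate
# family, the Hodge conjecture on every `E_1^{a_1} × ⋯ × E_r^{a_r} × S^c × S′^d`

COR-CM (cell `pub-hodgecm2`, binder seat `b16` gen 38, count-neutral claim CM5-CLASSIF, file F4; theorems only, no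
definition, no named fact).  NEW as stated, hence under `Summits/`.

The mechanism of seat p2's `CurvesTimesDihedralReflexPairCMHodge` (a BLOCK partial conjugation `τ²` for the two
surfaces, trivial on every imaginary quadratic slot, and the block splitting `isNondegenerateFamily_iff_of_block`) made
uniform by one observation about quartic CM fields:

* §1 **`smul_smul_eq_self_or_conjugate_of_finrank_eq_four`** (Lemma Q) — for ANY quartic CM field `K` and ANY
  `γ ∈ Aut(ℂ)`, `γ²` acts on `Hom(K, ℂ)` either trivially or as complex conjugation (the permutations of
  `{a, ā, b, b̄}` commuting with conjugation form a dihedral group of order `8` whose squares are `1` and `(a ā)(b b̄)`);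
* §2 **`exists_blockConj_two_quartic`** — for two quartic CM fields `K_{i₀}`, `K_{i₁}` each admitting a square root
  of conjugation `τ_k ∈ Aut(ℂ)` on its embeddings (every quartic CM field with a primitive type, seat p2), one of `τ₀²`,
  `τ₁²`, `τ₀² τ₁²` is complex conjugation on `Hom(K_{i₀}, ℂ) ∪ Hom(K_{i₁}, ℂ)` and the identity on the embeddings of
  every imaginary quadratic slot (squares are trivial there, `QuarticCM.smul_smul_eq_self_of_finrank_eq_two`);
* §3 **`isNondegenerateFamily_curves_simpleSurfaces`** — a family of realisations whose slots off `B = {i₀, i₁}` are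
  pairwise non-isogenous CM elliptic curves and whose block consists of two SIMPLE, NON-ISOGENOUS CM abelian SURFACES
  (any quartic CM fields — equal, isomorphic, reflex, cyclic, of equal or different closures — and any types) is
  NONDEGENERATE: the block is nondegenerate by seat b23's junction `isNondegenerateFamily_simpleSurfaces`, the curves by
  separation (seat b16 gen 35), and §2 glues; **`hodgeConjectureFor_prod_curves_simpleSurfaces`**,
  `hodgeClassSpan_prod_eq_divisorClassesSpan_curves_simpleSurfaces` — the Hodge conjecture and `B• = D•` on every
  `⨁_{k<N} A_{π k}` = every `E_1^{a_1} × ⋯ × E_r^{a_r} × S^c × S′^d`, UNCONDITIONALLY (Moonen–Zarhin (0.2) (4) for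
  `E × S × S′`, CM case; the partition `{2,2,1}`).

## References

* [MoonenZarhin1999LowDim] B. Moonen, Yu. Zarhin, *Hodge classes on abelian varieties of low dimension*, Math. Ann.
  315 (1999) 711–733, Thm. (0.2) (4), Cor. (3.9) and «Hodge groups of simple abelian surfaces of CM-type».
* [Shimura1998] G. Shimura, *Abelian Varieties with Complex Multiplication and Modular Functions*, §8.4 Example (2).
* [Gordon1999HodgeAVSurvey] B. B. Gordon, *A survey of the Hodge conjecture for abelian varieties*, §3 Theorem, 7.5, 10.10.
-/

noncomputable section

open CategoryTheory CategoryTheory.Limits NumberField NumberField.ComplexEmbedding IntermediateField Module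
open scoped BigOperators

namespace Summit.HodgeConjecture.CorCM

open Literature.NumberTheory.ComplexMultiplication
open Literature.AlgebraicGeometry.Motives (AbelianVariety CMType)
open Literature.AlgebraicGeometry.Motives.AbelianVariety
open Literature.AlgebraicGeometry.HodgeTheory
open Literature.AlgebraicGeometry.ComplexMultiplication (IsCMTypeRealisation isSimple_iff_isPrimitive)
open Literature.AlgebraicGeometry.VanGeemen1994 (hodgeClassSpan)
open Literature.AlgebraicGeometry.Pohlmann1968
open Literature.Barriers.HodgeConjecture (divisorClassesSpan)
open QuarticCM (conjugate_ne smul_conjugate)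

/-! ## §1 Lemma Q: the square of an automorphism of `ℂ` is trivial or conjugation on the embeddings of a quartic CM field -/

section LemmaQ

variable {K : Type} [Field K] [NumberField K] [IsCMField K]

/-- **Lemma Q.**  For a quartic CM field `K` and any `γ ∈ Aut(ℂ)`, `γ ∘ γ` acts on `Hom(K, ℂ) = {a, ā, b, b̄}` either as
the identity or as complex conjugation: the permutations commuting with the fixed-point-free involution `s ↦ s̄` form a
dihedral group of order `8`, whose squares are `1` and `(a ā)(b b̄)`.  (Case analysis on `γ a ∈ {a, ā, b, b̄}` and
`γ b`.) [cite: Shimura1998, §8.4 Example (2)] -/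
theorem smul_smul_eq_self_or_conjugate_of_finrank_eq_four (h4 : finrank ℚ K = 4) (γ : ℂ ≃+* ℂ) :
    (∀ s : K →+* ℂ, γ • γ • s = s) ∨ (∀ s : K →+* ℂ, γ • γ • s = conjugate s) := by
  obtain ⟨a⟩ : Nonempty (K →+* ℂ) := inferInstance
  obtain ⟨b, hba, hba'⟩ := QuarticCM.exists_ne_ne_conjugate h4 a
  have hinv : ∀ s : K →+* ℂ, conjugate (conjugate s) = s := involutive_conjugate K
  have hab' : a ≠ conjugate b := fun h => hba' (by rw [h, hinv])
  -- it suffices to know `γ²` on `a` and `b`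
  have key : ∀ {u : (K →+* ℂ) → (K →+* ℂ)}, (u = id ∨ u = conjugate) →
      γ • γ • a = u a → γ • γ • b = u b → ∀ s : K →+* ℂ, γ • γ • s = u s := by
    rintro u hu ha hb s
    rcases QuarticCM.eq_or_eq_or_eq_or_eq h4 hba hba' s with rfl | rfl | rfl | rfl
    · exact ha
    · rw [smul_conjugate, smul_conjugate, ha]
      rcases hu with rfl | rfl <;> rfl
    · exact hb
    · rw [smul_conjugate, smul_conjugate, hb]
      rcases hu with rfl | rfl <;> rfl
  have hinj : ∀ {x y : K →+* ℂ}, γ • x = γ • y → x = y := fun h => (smul_left_cancel_iff γ).1 h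
  rcases QuarticCM.eq_or_eq_or_eq_or_eq h4 hba hba' (γ • a) with ha | ha | ha | ha
  · -- `γ a = a`
    have ha' : γ • conjugate a = conjugate a := by rw [smul_conjugate, ha]
    left
    refine key (Or.inl rfl) (by rw [ha, ha]) ?_
    rcases QuarticCM.eq_or_eq_or_eq_or_eq h4 hba hba' (γ • b) with hb | hb | hb | hb
    · exact (hba (hinj (hb.trans ha.symm))).elim
    · exact (hba' (hinj (hb.trans ha'.symm))).elim
    · rw [hb, hb]
    · rw [hb, smul_conjugate, hb, hinv]
  · -- `γ a = ā`
    have ha' : γ • conjugate a = a := by rw [smul_conjugate, ha, hinv]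
    left
    refine key (Or.inl rfl) (by rw [ha, ha']) ?_
    rcases QuarticCM.eq_or_eq_or_eq_or_eq h4 hba hba' (γ • b) with hb | hb | hb | hb
    · exact (hba' (hinj (hb.trans ha'.symm))).elim
    · exact (hba (hinj (hb.trans ha.symm))).elim
    · rw [hb, hb]
    · rw [hb, smul_conjugate, hb, hinv]
  · -- `γ a = b`
    have ha' : γ • conjugate a = conjugate b := by rw [smul_conjugate, ha]
    rcases QuarticCM.eq_or_eq_or_eq_or_eq h4 hba hba' (γ • b) with hb | hb | hb | hb
    · left
      exact key (Or.inl rfl) (by rw [ha, hb]) (by rw [hb, ha])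
    · right
      exact key (Or.inr rfl) (by rw [ha, hb]) (by rw [hb, ha'])
    · exact (hba (hinj (hb.trans ha.symm))).elim
    · exact (hba' (hinj (hb.trans ha'.symm))).elim
  · -- `γ a = b̄`
    have ha' : γ • conjugate a = b := by rw [smul_conjugate, ha, hinv]
    rcases QuarticCM.eq_or_eq_or_eq_or_eq h4 hba hba' (γ • b) with hb | hb | hb | hb
    · right
      exact key (Or.inr rfl) (by rw [ha, smul_conjugate, hb]) (by rw [hb, ha])
    · left
      exact key (Or.inl rfl) (by rw [ha, smul_conjugate, hb, hinv]) (by rw [hb, ha'])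
    · exact (hba' (hinj (hb.trans ha'.symm))).elim
    · exact (hba (hinj (hb.trans ha.symm))).elim

end LemmaQ

/-! ## §2 A block partial conjugation for any two quartic CM fields with square roots of conjugation -/

section Block

variable {I : Type} {K : I → Type} [∀ i, Field (K i)] [∀ i, NumberField (K i)] [∀ i, IsCMField (K i)]

/-- **Block partial conjugation for two quartic slots.**  If `τ₀² = conj` on `Hom(K_{i₀}, ℂ)` and `τ₁² = conj` on
`Hom(K_{i₁}, ℂ)` (`K_{i₀}`, `K_{i₁}` quartic CM) and every other slot is imaginary quadratic, then some `σ ∈ Aut(ℂ)` —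
one of `τ₀²`, `τ₁²`, `τ₀²τ₁²`, by Lemma Q — is complex conjugation on both quartic slots and the identity on all the
quadratic ones (squares are trivial on two embeddings). [cite: Shimura1998, §8.4 Example (2)]
[cite: Gordon1999HodgeAVSurvey, §3 Theorem (proof)] -/
theorem exists_blockConj_two_quartic (p : I → Prop) {i₀ i₁ : I} (hpI : ∀ i, p i ↔ i = i₀ ∨ i = i₁)
    (h4₀ : finrank ℚ (K i₀) = 4) (h4₁ : finrank ℚ (K i₁) = 4) (h2 : ∀ j, ¬p j → finrank ℚ (K j) = 2)
    {τ₀ τ₁ : ℂ ≃+* ℂ} (hτ₀ : ∀ s : K i₀ →+* ℂ, τ₀ • τ₀ • s = conjugate s)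
    (hτ₁ : ∀ s : K i₁ →+* ℂ, τ₁ • τ₁ • s = conjugate s) :
    ∃ σ : ℂ ≃+* ℂ, (∀ i, p i → ∀ s : K i →+* ℂ, σ • s = conjugate s) ∧
      ∀ j, ¬p j → ∀ s : K j →+* ℂ, σ • s = s := by
  -- a `σ` that is conjugation on both quartic slots works, provided it is a product of squares
  have pack : ∀ σ : ℂ ≃+* ℂ, (∀ s : K i₀ →+* ℂ, σ • s = conjugate s) → (∀ s : K i₁ →+* ℂ, σ • s = conjugate s) →
      (∀ j, ¬p j → ∀ s : K j →+* ℂ, σ • s = s) →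
      ∃ σ : ℂ ≃+* ℂ, (∀ i, p i → ∀ s : K i →+* ℂ, σ • s = conjugate s) ∧
        ∀ j, ¬p j → ∀ s : K j →+* ℂ, σ • s = s := by
    intro σ h₀ h₁ h'
    refine ⟨σ, fun i hi => ?_, h'⟩
    rcases (hpI i).1 hi with rfl | rfl
    · exact h₀
    · exact h₁
  rcases smul_smul_eq_self_or_conjugate_of_finrank_eq_four h4₁ τ₀ with h01 | h01
  · rcases smul_smul_eq_self_or_conjugate_of_finrank_eq_four h4₀ τ₁ with h10 | h10
    · -- `σ = τ₀² τ₁²`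
      refine pack (τ₀ * τ₀ * (τ₁ * τ₁)) (fun s => ?_) (fun s => ?_) (fun j hj s => ?_)
      · rw [mul_smul, mul_smul, mul_smul, h10, hτ₀]
      · rw [mul_smul, mul_smul, mul_smul, hτ₁, smul_conjugate, smul_conjugate, h01]
      · rw [mul_smul, mul_smul, mul_smul, QuarticCM.smul_smul_eq_self_of_finrank_eq_two (h2 j hj),
          QuarticCM.smul_smul_eq_self_of_finrank_eq_two (h2 j hj)]
    · -- `σ = τ₁²`
      refine pack (τ₁ * τ₁) (fun s => ?_) (fun s => ?_) (fun j hj s => ?_)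
      · rw [mul_smul, h10]
      · rw [mul_smul, hτ₁]
      · rw [mul_smul, QuarticCM.smul_smul_eq_self_of_finrank_eq_two (h2 j hj)]
  · -- `σ = τ₀²`
    refine pack (τ₀ * τ₀) (fun s => ?_) (fun s => ?_) (fun j hj s => ?_)
    · rw [mul_smul, hτ₀]
    · rw [mul_smul, h01]
    · rw [mul_smul, QuarticCM.smul_smul_eq_self_of_finrank_eq_two (h2 j hj)]

end Block

/-! ## §3 Curves times two simple, non-isogenous CM surfaces -/

section Geometry

variable {I : Type} {K : I → Type} [∀ i, Field (K i)] [∀ i, NumberField (K i)] [∀ i, IsCMField (K i)] [Fintype I]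
  {Φ : ∀ i, CMType (K i)}
variable {A : I → AbelianVariety ℂ} {ι : ∀ i, 𝓞 (K i) →+* End (A i)}
  {θ : ∀ i, K i →+* Module.End ℂ (complexBetti (A i).X 1)}

/-- **Curves × two simple non-isogenous CM surfaces: a NONDEGENERATE family.**  Block `B = {i₀, i₁}` (`p i ↔ i = i₀ ∨
i = i₁`, `i₀ ≠ i₁`) carrying two SIMPLE, NON-ISOGENOUS CM abelian surfaces (realisations of types of quartic CM fields —
any fields, any types), the slots off `B` imaginary quadratic with a SEPARATING sub-family of types (pairwise
non-isogenous CM elliptic curves).  Then `(Φ_i)_i` is nondegenerate: `rank Hg(∏_a E_a × S × S′) = r + 4`.  Proof: block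
partial conjugation (§2, the 4-cycles of simple surfaces, seat p2) + block splitting (`isNondegenerateFamily_iff_of_block`,
seat p2) + the surface pair (`isNondegenerateFamily_simpleSurfaces`, seat b23) + the curves (seat b16 gen 35).
[cite: MoonenZarhin1999LowDim, Thm. (0.2) (4) and Cor. (3.9)] [cite: Gordon1999HodgeAVSurvey, §3 Theorem and 7.5] -/
theorem isNondegenerateFamily_curves_simpleSurfaces (p : I → Prop) [DecidablePred p] {i₀ i₁ : I} (h01 : i₀ ≠ i₁)
    (hpI : ∀ i, p i ↔ i = i₀ ∨ i = i₁) (h4₀ : finrank ℚ (K i₀) = 4) (h4₁ : finrank ℚ (K i₁) = 4)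
    (h2 : ∀ j, ¬p j → finrank ℚ (K j) = 2) (hA : ∀ i, IsCMTypeRealisation (Φ i) (A i) (ι i) (θ i))
    (hS₀ : (A i₀).IsSimple) (hS₁ : (A i₁).IsSimple) (hniso : ¬ AbelianVariety.IsIsogenous (A i₀) (A i₁))
    (hsep : CMAlgebra.IsSeparatingFamily (fun j : {j // ¬p j} => Φ j.1)) : CMAlgebra.IsNondegenerateFamily Φ := by
  classical
  haveI : Nonempty I := ⟨i₀⟩
  have hp₀ : p i₀ := (hpI i₀).2 (Or.inl rfl)
  have hp₁ : p i₁ := (hpI i₁).2 (Or.inr rfl)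
  -- the block `{S, S′}` is nondegenerate (seat b23's junction, applied to the restricted family)
  have hI' : ∀ j : {i // p i}, j = ⟨i₀, hp₀⟩ ∨ j = ⟨i₁, hp₁⟩ := fun j => by
    rcases (hpI j.1).1 j.2 with h | h
    · exact Or.inl (Subtype.ext h)
    · exact Or.inr (Subtype.ext h)
  have h01' : (⟨i₀, hp₀⟩ : {i // p i}) ≠ ⟨i₁, hp₁⟩ := fun h => h01 (congrArg Subtype.val h)
  have h4' : ∀ j : {i // p i}, finrank ℚ (K j.1) = 4 := fun j => by
    rcases hI' j with rfl | rfl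
    · exact h4₀
    · exact h4₁
  have hS' : ∀ j : {i // p i}, (A j.1).IsSimple := fun j => by
    rcases hI' j with rfl | rfl
    · exact hS₀
    · exact hS₁
  have hniso' : ∀ j j' : {i // p i}, j ≠ j' → ¬ AbelianVariety.IsIsogenous (A j.1) (A j'.1) := by
    intro j j' hjj'
    rcases hI' j with rfl | rfl <;> rcases hI' j' with rfl | rfl
    · exact (hjj' rfl).elim
    · exact hniso
    · exact fun h => hniso (AbelianVariety.IsIsogenous.symm' h)
    · exact (hjj' rfl).elim
  haveI : Nonempty {i // p i} := ⟨⟨i₀, hp₀⟩⟩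
  have hblock : CMAlgebra.IsNondegenerateFamily (fun j : {i // p i} => Φ j.1) :=
    isNondegenerateFamily_simpleSurfaces (K := fun j : {i // p i} => K j.1) (Φ := fun j => Φ j.1)
      (A := fun j => A j.1) (ι := fun j => ι j.1) (θ := fun j => θ j.1) h01' hI' h4' (fun j => hA j.1) hS' hniso'
  -- glue along a block partial conjugation (if there is a curve at all)
  by_cases hnp : ∃ j, ¬p j
  · obtain ⟨j₀, hj₀⟩ := hnp
    haveI : Nonempty {j // ¬p j} := ⟨⟨j₀, hj₀⟩⟩
    have hcurves : CMAlgebra.IsNondegenerateFamily (fun j : {j // ¬p j} => Φ j.1) :=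
      isNondegenerateFamily_of_finrank_eq_two (fun j => h2 j.1 j.2) hsep
    obtain ⟨τ₀, hτ₀⟩ := QuarticCM.exists_ringAut_smul_smul_eq_conjugate_of_isPrimitive h4₀
      ((isSimple_iff_isPrimitive (hA i₀) (Classical.arbitrary _)).1 hS₀)
    obtain ⟨τ₁, hτ₁⟩ := QuarticCM.exists_ringAut_smul_smul_eq_conjugate_of_isPrimitive h4₁
      ((isSimple_iff_isPrimitive (hA i₁) (Classical.arbitrary _)).1 hS₁)
    obtain ⟨σ, hσ, hσ'⟩ := exists_blockConj_two_quartic p hpI h4₀ h4₁ h2 hτ₀ hτ₁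
    exact (isNondegenerateFamily_iff_of_block p hσ hσ' ⟨i₀, hp₀⟩ ⟨j₀, hj₀⟩ Φ).2 ⟨hblock, hcurves⟩
  · -- every slot is in the block: the family IS the surface pair
    push Not at hnp
    have hI : ∀ j, j = i₀ ∨ j = i₁ := fun j => (hpI j).1 (hnp j)
    exact isNondegenerateFamily_simpleSurfaces h01 hI (fun i => by
      rcases hI i with rfl | rfl
      · exact h4₀
      · exact h4₁) hA (fun i => by
      rcases hI i with rfl | rfl
      · exact hS₀
      · exact hS₁) fun i j hij => by
      rcases hI i with rfl | rfl <;> rcases hI j with rfl | rfl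
      · exact (hij rfl).elim
      · exact hniso
      · exact fun h => hniso (AbelianVariety.IsIsogenous.symm' h)
      · exact (hij rfl).elim

/-- **`Bᵐ ⊗ ℂ = Dᵐ ⊗ ℂ` on every `E_1^{a_1} × ⋯ × E_r^{a_r} × S^c × S′^d`** (every `⨁_{k<N} A_{π k}`) for pairwise
non-isogenous CM elliptic curves and two simple, non-isogenous CM abelian surfaces. [cite: MoonenZarhin1999LowDim, Thm. (0.2) (4)]
[cite: Gordon1999HodgeAVSurvey, 7.5] -/
theorem hodgeClassSpan_prod_eq_divisorClassesSpan_curves_simpleSurfaces (p : I → Prop) [DecidablePred p]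
    {i₀ i₁ : I} (h01 : i₀ ≠ i₁) (hpI : ∀ i, p i ↔ i = i₀ ∨ i = i₁) (h4₀ : finrank ℚ (K i₀) = 4)
    (h4₁ : finrank ℚ (K i₁) = 4) (h2 : ∀ j, ¬p j → finrank ℚ (K j) = 2)
    (hA : ∀ i, IsCMTypeRealisation (Φ i) (A i) (ι i) (θ i)) (hS₀ : (A i₀).IsSimple) (hS₁ : (A i₁).IsSimple)
    (hniso : ¬ AbelianVariety.IsIsogenous (A i₀) (A i₁))
    (hsep : CMAlgebra.IsSeparatingFamily (fun j : {j // ¬p j} => Φ j.1)) {N : ℕ} (π : Fin N → I) (m : ℕ) :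
    hodgeClassSpan (⨁ fun j : Fin N => A (π j)).dim (⨁ fun j : Fin N => A (π j)).X m =
      divisorClassesSpan (⨁ fun j : Fin N => A (π j)).X (⨁ fun j : Fin N => A (π j)).dim m := by
  haveI : Nonempty I := ⟨i₀⟩
  exact (isNondegenerateFamily_curves_simpleSurfaces p h01 hpI h4₀ h4₁ h2 hA hS₀ hS₁ hniso hsep)
    |>.hodgeClassSpan_prod_eq_divisorClassesSpan hA π m

/-- **The Hodge conjecture for every `E_1^{a_1} × ⋯ × E_r^{a_r} × S^c × S′^d`** (every `⨁_{k<N} A_{π k}`): pairwise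
non-isogenous CM elliptic curves `E_a` and two SIMPLE, NON-ISOGENOUS CM abelian surfaces `S, S′` with ARBITRARY quartic CM
fields and types — UNCONDITIONALLY (Moonen–Zarhin (0.2) (4) with Hazama–Murty, CM case; dimension `5`: `E × S × S′`).
[cite: MoonenZarhin1999LowDim, Thm. (0.2) (4) and Cor. (3.9)] [cite: Gordon1999HodgeAVSurvey, 7.5 and 10.10] -/
theorem hodgeConjectureFor_prod_curves_simpleSurfaces (p : I → Prop) [DecidablePred p] {i₀ i₁ : I} (h01 : i₀ ≠ i₁)
    (hpI : ∀ i, p i ↔ i = i₀ ∨ i = i₁) (h4₀ : finrank ℚ (K i₀) = 4) (h4₁ : finrank ℚ (K i₁) = 4)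
    (h2 : ∀ j, ¬p j → finrank ℚ (K j) = 2) (hA : ∀ i, IsCMTypeRealisation (Φ i) (A i) (ι i) (θ i))
    (hS₀ : (A i₀).IsSimple) (hS₁ : (A i₁).IsSimple) (hniso : ¬ AbelianVariety.IsIsogenous (A i₀) (A i₁))
    (hsep : CMAlgebra.IsSeparatingFamily (fun j : {j // ¬p j} => Φ j.1)) {N : ℕ} (π : Fin N → I) :
    HodgeConjectureFor (⨁ fun j : Fin N => A (π j)).dim (⨁ fun j : Fin N => A (π j)).X := by
  haveI : Nonempty I := ⟨i₀⟩
  exact (isNondegenerateFamily_curves_simpleSurfaces p h01 hpI h4₀ h4₁ h2 hA hS₀ hS₁ hniso hsep)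
    |>.hodgeConjectureFor_prod hA π

/-- **The same with the curves given as PAIRWISE NON-ISOGENOUS CM elliptic curves** (realisations of imaginary quadratic
fields; separation of their types follows, `isSeparatingFamily_of_isSimple_of_pairwise_not_isIsogenous` on the curve
slots). [cite: MoonenZarhin1999LowDim, Thm. (0.2) (4) and Cor. (3.9)] [cite: Gordon1999HodgeAVSurvey, §3 Theorem and 10.10] -/
theorem hodgeConjectureFor_prod_curves_simpleSurfaces_of_not_isIsogenous (p : I → Prop) [DecidablePred p]
    {i₀ i₁ : I} (h01 : i₀ ≠ i₁) (hpI : ∀ i, p i ↔ i = i₀ ∨ i = i₁) (h4₀ : finrank ℚ (K i₀) = 4)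
    (h4₁ : finrank ℚ (K i₁) = 4) (h2 : ∀ j, ¬p j → finrank ℚ (K j) = 2)
    (hA : ∀ i, IsCMTypeRealisation (Φ i) (A i) (ι i) (θ i)) (hS₀ : (A i₀).IsSimple) (hS₁ : (A i₁).IsSimple)
    (hniso : ¬ AbelianVariety.IsIsogenous (A i₀) (A i₁))
    (hcurves : ∀ j j', ¬p j → ¬p j' → j ≠ j' → ¬ AbelianVariety.IsIsogenous (A j) (A j')) {N : ℕ} (π : Fin N → I) :
    HodgeConjectureFor (⨁ fun j : Fin N => A (π j)).dim (⨁ fun j : Fin N => A (π j)).X ∧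
      ∀ m : ℕ, hodgeClassSpan (⨁ fun j : Fin N => A (π j)).dim (⨁ fun j : Fin N => A (π j)).X m =
        divisorClassesSpan (⨁ fun j : Fin N => A (π j)).X (⨁ fun j : Fin N => A (π j)).dim m := by
  have hsep : CMAlgebra.IsSeparatingFamily (fun j : {j // ¬p j} => Φ j.1) :=
    CMAlgebra.isSeparatingFamily_of_isSimple_of_pairwise_not_isIsogenous (K := fun j : {j // ¬p j} => K j.1)
      (A := fun j => A j.1) (ι := fun j => ι j.1) (θ := fun j => θ j.1) (fun j => hA j.1)
      (fun j => AbelianVariety.isSimple_of_dim_le_one (by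
        have h := Literature.AlgebraicGeometry.Pohlmann1968.finrank_eq_two_mul_dim_of_isCMTypeRealisation (hA j.1)
        rw [h2 j.1 j.2] at h
        omega))
      (fun j j' hjj' => hcurves j.1 j'.1 j.2 j'.2 fun h => hjj' (Subtype.ext h))
  exact ⟨hodgeConjectureFor_prod_curves_simpleSurfaces p h01 hpI h4₀ h4₁ h2 hA hS₀ hS₁ hniso hsep π, fun m =>
    hodgeClassSpan_prod_eq_divisorClassesSpan_curves_simpleSurfaces p h01 hpI h4₀ h4₁ h2 hA hS₀ hS₁ hniso hsep π m⟩

end Geometry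

end Summit.HodgeConjecture.CorCM

end
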